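import Summits.ValiantsHypothesis.ValiantsHypothesis.Theorems.KPlusLogSqLawTropicalShiftDiamond

/-!
# Route «KPlusLogSqLaw» — DIAMOND, part 2: the domination inequalities and per-incidence domination

HONEST FRAMING.  Proof file (pure theorems), part 2 of the helper chain `--supports` the crux
`Summit.ValiantsHypothesis.ValiantsHypothesis.Theses.KPlusLogSqLaw.TropicalB` (ledger item `stmt-ValiantsHypothesis-19771`, route `KPlusLogSqLaw`;
object-search cell `pub-symmetroid`, seat val-sym-trop-p5 g8, 2026-08-27).  Nothing here asserts `TropicalB`, `WeakLifting`, `KPlusLogSqLaw`,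
`MatrixDescartes` or anything about `VP ≠ VNP`; the family is quadratic in `m` (leading constant `K − 3`), far inside every open question of the
cell (the `K = 4` fork, the window of `TropicalB`).
CONTENTS.  `g(p) − g(q) = κ(p − q)(θ − W(p+q+1))` (`gval_sub`); the universal bonus bound `bonus ≤ j·(θ − 2W·q − 2)` (`bonus_le_linear`,
companion counts and positions being nonnegative); at `θ(P,s)` the gap to a SMALLER effective shift beats `a·(θ − 2Wq − 2)` and is positive
(`gval_gap_of_lt`, `κ = 2aW + 2a + 1`), a LARGER effective shift loses outright (`gval_gap_of_gt`, `s < W`); at the phase's own shift the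
round-robin rung is the unique best rung (`bonus_sub`, `lvl_spec`, `lvl_le`, `bonus_le_lvl`, `bonus_lt_lvl`; `bonus_grid_nonneg`).  Hence
(`phi_le`, `phi_lt`) every incidence of column `b` scores at most the grid incidence at `θ(P,s)`, strictly unless it IS it, and
(`isDominant_cterm`) the grid term of `(P, s)` is the unique optimum for all `P ≤ 2m`, `s ≤ a·climb P`.  Part 3: `…ShiftDiamondChain`. -/

set_option linter.dupNamespace false
set_option autoImplicit false

namespace Summit.ValiantsHypothesis.ValiantsHypothesis.Theorems.LacunarySymmetroidMatrixDescartes.TropicalCensus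

open Summit.ValiantsHypothesis.ValiantsHypothesis.Theorems.MatrixDescartes.Negative
open scoped BigOperators
open Finset

namespace ShiftDiamond
open ShiftThree (shiftZ)
open ShiftSquare (rot)
variable (a n : ℕ)

/-! ### the domination inequalities -/

/-- difference of shift scores, factored: `g(p) − g(q) = κ(p − q)(θ − W(p+q+1))`. -/
theorem gval_sub (θ p q : ℤ) :
    gval a n θ p - gval a n θ q = (kap a n : ℤ) * (p - q) * (θ - (width a n : ℤ) * (q + p + 1)) := by
  unfold gval pen; ring

/-- a universal upper bound for the rung bonus of any incidence: `bonus ≤ j·(θ − 2W·q − 2)` (positions and companion counts are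
nonnegative). -/
theorem bonus_le_linear (θ q : ℤ) (c ps : ℤ) (hc : 0 ≤ c) (hps : 0 ≤ ps) (j : ℕ) :
    bonus a n θ q c ps j ≤ (j : ℤ) * (θ - 2 * (width a n : ℤ) * q - 2) := by
  unfold bonus priceSum
  have hj : (0 : ℤ) ≤ (j : ℤ) := by positivity
  have h1 : (0 : ℤ) ≤ (j : ℤ) * ((j : ℤ) - 1) := by
    rcases Nat.eq_zero_or_pos j with h0 | h0
    · subst h0; simp
    · have : (1 : ℤ) ≤ (j : ℤ) := by exact_mod_cast h0
      nlinarith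
  nlinarith [mul_nonneg hc h1, mul_nonneg hj hps]

/-- `cnt ≥ 0`. -/
theorem cnt_nonneg (r b : Fin (n + 1)) : 0 ≤ cnt n r b := by
  unfold cnt; have := ShiftSquare.shiftZ_bounds n r b; split_ifs <;> omega

/-- `pos ≥ 0`. -/
theorem pos_nonneg (r b : Fin (n + 1)) : 0 ≤ pos n r b := by
  unfold pos; split_ifs <;> positivity

/-- **the gap beats the bonus below the phase**: for `q < P` (integer), at `θ(P, s)`,
`g(P) − g(q) > a·(θ − 2W·q − 2)` and `g(P) − g(q) > 0`. -/
theorem gval_gap_of_lt (P s : ℕ) (q : ℤ) (hq : q < P) :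
    (a : ℤ) * (th a n P s - 2 * (width a n : ℤ) * q - 2) < gval a n (th a n P s) P - gval a n (th a n P s) q ∧
      0 < gval a n (th a n P s) P - gval a n (th a n P s) q := by
  rw [gval_sub, kap_cast]
  unfold th
  set W : ℤ := (width a n : ℤ) with hWdef
  have hW : (1 : ℤ) ≤ W := by rw [hWdef, width_cast]; nlinarith
  set t : ℤ := (P : ℤ) - q with ht
  have ht1 : (1 : ℤ) ≤ t := by rw [ht]; linarith
  have ha : (0 : ℤ) ≤ (a : ℤ) := by positivity
  have hs : (0 : ℤ) ≤ (s : ℤ) := by positivity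
  -- rewrite everything in terms of `t`
  have e1 : (2 * W * P + 2 * s + 1 - W * (q + P + 1)) = W * (t - 1) + 2 * s + 1 := by rw [ht]; ring
  have e2 : (2 * W * (P : ℤ) + 2 * s + 1 - 2 * W * q - 2) = 2 * W * t + 2 * s - 1 := by rw [ht]; ring
  rw [e1, e2]
  have hB : (0 : ℤ) ≤ W * (t - 1) + 2 * s + 1 := by nlinarith
  have hk : (0 : ℤ) ≤ 2 * (a : ℤ) * W + 2 * a + 1 := by nlinarith
  -- `κ·t·B ≥ κ·B` and `κ·B ≥ …`
  have h1 : (2 * (a : ℤ) * W + 2 * a + 1) * t * (W * (t - 1) + 2 * s + 1) ≥ (2 * (a : ℤ) * W + 2 * a + 1) * (W * (t - 1) + 2 * s + 1) := by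
    have := mul_le_mul_of_nonneg_left ht1 (mul_nonneg hk hB)
    nlinarith
  have hW0 : (0 : ℤ) ≤ W := by linarith
  have h3 : (0 : ℤ) ≤ t - 1 := by linarith
  have hx1 : (0 : ℤ) ≤ (a : ℤ) * W * s := mul_nonneg (mul_nonneg ha hW0) hs
  have hx2 : (0 : ℤ) ≤ (a : ℤ) * s := mul_nonneg ha hs
  have hx3 : (0 : ℤ) ≤ (a : ℤ) * W := mul_nonneg ha hW0
  have hx4 : (0 : ℤ) ≤ (a : ℤ) * W * (t - 1) := mul_nonneg hx3 h3
  have hx5 : (0 : ℤ) ≤ (a : ℤ) * (t - 1) := mul_nonneg ha h3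
  have hx6 : (0 : ℤ) ≤ W * (t - 1) := mul_nonneg hW0 h3
  have h2 : (2 * (a : ℤ) * W + 2 * a + 1) * (W * (t - 1)) ≥ 2 * (a : ℤ) * W * (t - 1) := by
    nlinarith [mul_nonneg hx3 hx6, mul_nonneg ha hx6]
  have hkB : (2 * (a : ℤ) * W + 2 * a + 1) * (W * (t - 1) + 2 * s + 1)
      = (2 * (a : ℤ) * W + 2 * a + 1) * (W * (t - 1)) + (2 * (a : ℤ) * W + 2 * a + 1) * (2 * s + 1) := by ring
  have hk2 : (2 * (a : ℤ) * W + 2 * a + 1) * (2 * (s : ℤ) + 1)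
      = 4 * ((a : ℤ) * W * s) + 2 * ((a : ℤ) * W) + 4 * ((a : ℤ) * s) + 2 * a + 2 * s + 1 := by ring
  constructor
  · nlinarith
  · nlinarith

/-- a larger effective shift loses outright at every step `s ≤ a·m` (`< W`) of the phase. -/
theorem gval_gap_of_gt (P s : ℕ) (hs : s < width a n) (q : ℤ) (hq : (P : ℤ) < q) :
    0 < gval a n (th a n P s) P - gval a n (th a n P s) q := by
  rw [gval_sub]
  unfold th
  have hW := width_cast a n
  have h1 : (1 : ℤ) ≤ q - P := by linarith
  have hs' : (s : ℤ) + 1 ≤ (width a n : ℤ) := by exact_mod_cast hs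
  have hF : (1 : ℤ) ≤ (width a n : ℤ) * (q + (P : ℤ) + 1) - (2 * (width a n : ℤ) * P + 2 * s + 1) := by
    nlinarith
  have hk : (0 : ℤ) < (kap a n : ℤ) := by rw [kap_cast, hW]; positivity
  have h2 : (kap a n : ℤ) * (P - q) * (2 * (width a n : ℤ) * P + 2 * s + 1 - (width a n : ℤ) * (q + P + 1))
      = (kap a n : ℤ) * (q - P) * ((width a n : ℤ) * (q + (P : ℤ) + 1) - (2 * (width a n : ℤ) * P + 2 * s + 1)) := by
    ring
  rw [h2]
  positivity

/-- the bonus at the phase's own shift, factored. -/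
theorem bonus_sub (P s : ℕ) (c ps : ℤ) (j j' : ℕ) :
    bonus a n (th a n P s) P c ps j - bonus a n (th a n P s) P c ps j' =
      ((j : ℤ) - j') * (2 * ((s : ℤ) - ps) - 1 - c * ((j : ℤ) + j' - 1)) := by
  unfold bonus priceSum th; ring

/-- the round-robin level lies in its window: `c·lvl + ps + 1 ≤ s + c` and `s ≤ c·lvl + ps` (for `ps < c`). -/
theorem lvl_spec (c s ps : ℕ) (hps : ps < c) :
    c * lvl c s ps + ps + 1 ≤ s + c ∧ s ≤ c * lvl c s ps + ps := by
  unfold lvl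
  have h := Nat.div_add_mod s c
  have hc := Nat.mod_lt s (show 0 < c by omega)
  by_cases hlt : ps < s % c
  · rw [if_pos hlt, Nat.mul_succ]
    constructor <;> omega
  · simp only [if_neg hlt, Nat.add_zero]
    constructor <;> omega

/-- the round-robin level is at most `a` when `s ≤ a·c`. -/
theorem lvl_le (c s : ℕ) (hs : s ≤ a * c) (ps : ℕ) (hps : ps < c) : lvl c s ps ≤ a := by
  unfold lvl
  have h := Nat.div_add_mod s c
  have hmod := Nat.mod_lt s (show 0 < c by omega)
  have hi : s / c ≤ a := by
    calc s / c ≤ a * c / c := Nat.div_le_div_right hs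
      _ = a := Nat.mul_div_cancel a (by omega)
  by_cases hlt : ps < s % c
  · rw [if_pos hlt]
    by_contra hcon
    have hA : s / c = a := by omega
    have : c * a + 1 ≤ s := by rw [← hA]; omega
    nlinarith
  · rw [if_neg hlt]; omega

/-- **the grid rung is the unique best rung at the phase's shift** (for a climbing column at position `ps < c`). -/
theorem bonus_le_lvl (P s : ℕ) (c ps : ℕ) (hps : ps < c) (j' : ℕ) :
    bonus a n (th a n P s) P c ps j' ≤ bonus a n (th a n P s) P c ps (lvl c s ps) := by
  obtain ⟨h1, h2⟩ := lvl_spec c s ps hps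
  set j := lvl c s ps with hj
  have h1' : (c : ℤ) * j + ps + 1 ≤ s + c := by exact_mod_cast h1
  have h2' : (s : ℤ) ≤ (c : ℤ) * j + ps := by exact_mod_cast h2
  have hsub := bonus_sub a n P s c ps j j'
  have hn : (0 : ℤ) ≤ (c : ℤ) := by positivity
  rcases lt_trichotomy j' j with hlt | heq | hgt
  · have hjj : (j' : ℤ) + 1 ≤ j := by exact_mod_cast hlt
    have hB : (c : ℤ) * ((j : ℤ) + j' - 1) ≤ (c : ℤ) * (2 * j - 2) := mul_le_mul_of_nonneg_left (by linarith) hn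
    have hA1 : (1 : ℤ) ≤ (j : ℤ) - j' := by linarith
    have hA2 : (1 : ℤ) ≤ 2 * ((s : ℤ) - ps) - 1 - (c : ℤ) * ((j : ℤ) + j' - 1) := by linarith
    have hm := mul_le_mul hA1 hA2 zero_le_one (by linarith)
    linarith
  · rw [heq]
  · have hjj : (j : ℤ) + 1 ≤ j' := by exact_mod_cast hgt
    have hB : (c : ℤ) * (2 * j) ≤ (c : ℤ) * ((j : ℤ) + j' - 1) := mul_le_mul_of_nonneg_left (by linarith) hn
    have hA1 : (1 : ℤ) ≤ (j' : ℤ) - j := by linarith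
    have hA2 : (1 : ℤ) ≤ -(2 * ((s : ℤ) - ps) - 1 - (c : ℤ) * ((j : ℤ) + j' - 1)) := by linarith
    have hm := mul_le_mul hA1 hA2 zero_le_one (by linarith)
    linarith

/-- … strictly unless `j' = lvl`. -/
theorem bonus_lt_lvl (P s : ℕ) (c ps : ℕ) (hps : ps < c) (j' : ℕ) (hne : j' ≠ lvl c s ps) :
    bonus a n (th a n P s) P c ps j' < bonus a n (th a n P s) P c ps (lvl c s ps) := by
  obtain ⟨h1, h2⟩ := lvl_spec c s ps hps
  set j := lvl c s ps with hj
  have h1' : (c : ℤ) * j + ps + 1 ≤ s + c := by exact_mod_cast h1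
  have h2' : (s : ℤ) ≤ (c : ℤ) * j + ps := by exact_mod_cast h2
  have hsub := bonus_sub a n P s c ps j j'
  have hn : (0 : ℤ) ≤ (c : ℤ) := by positivity
  rcases lt_trichotomy j' j with hlt | heq | hgt
  · have hjj : (j' : ℤ) + 1 ≤ j := by exact_mod_cast hlt
    have hB : (c : ℤ) * ((j : ℤ) + j' - 1) ≤ (c : ℤ) * (2 * j - 2) := mul_le_mul_of_nonneg_left (by linarith) hn
    have hA1 : (1 : ℤ) ≤ (j : ℤ) - j' := by linarith
    have hA2 : (1 : ℤ) ≤ 2 * ((s : ℤ) - ps) - 1 - (c : ℤ) * ((j : ℤ) + j' - 1) := by linarith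
    have hm := mul_le_mul hA1 hA2 zero_le_one (by linarith)
    linarith
  · exact absurd heq hne
  · have hjj : (j : ℤ) + 1 ≤ j' := by exact_mod_cast hgt
    have hB : (c : ℤ) * (2 * j) ≤ (c : ℤ) * ((j : ℤ) + j' - 1) := mul_le_mul_of_nonneg_left (by linarith) hn
    have hA1 : (1 : ℤ) ≤ (j' : ℤ) - j := by linarith
    have hA2 : (1 : ℤ) ≤ -(2 * ((s : ℤ) - ps) - 1 - (c : ℤ) * ((j : ℤ) + j' - 1)) := by linarith
    have hm := mul_le_mul hA1 hA2 zero_le_one (by linarith)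
    linarith

/-- the grid bonus is nonnegative. -/
theorem bonus_grid_nonneg (P s : ℕ) (hs : s ≤ a * climb n P) (b : Fin (n + 1)) :
    0 ≤ bonus a n (th a n P s) P (climb n P) (pcol n P b) (jcol a n P s b) := by
  unfold jcol
  by_cases hc : hcol n P b = 1
  · rw [if_pos hc]
    -- a climbing column: its position is `< climb P`
    have hps : pcol n P b < climb n P := by
      unfold pcol climb
      unfold hcol at hc
      have h := Nat.div_add_mod P (n + 1)
      have hr := ShiftGrid.mod_lt' n P
      have hb := b.isLt
      by_cases hw : n + 1 ≤ (b : ℕ) + P % (n + 1)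
      · rw [if_pos hw] at hc
        have he : P / (n + 1) = 0 := by omega
        rw [he] at h
        have hPn : P ≤ n := by omega
        rw [if_pos hPn, if_pos hPn]
        have : P % (n + 1) = P := Nat.mod_eq_of_lt (by omega)
        omega
      · rw [if_neg hw] at hc
        have he : P / (n + 1) = 1 := by omega
        rw [he] at h
        have hPn : ¬ P ≤ n := by omega
        rw [if_neg hPn, if_neg hPn]
        omega
    rw [min_eq_right (lvl_le a _ _ hs _ hps)]
    have h0 := bonus_le_lvl a n P s (climb n P) (pcol n P b) hps 0
    have e0 : bonus a n (th a n P s) P (climb n P) (pcol n P b) 0 = 0 := by unfold bonus priceSum; simp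
    linarith
  · rw [if_neg hc]
    unfold bonus priceSum; simp

/-! ### per-incidence domination -/

/-- **per-incidence domination** at `θ(P,s)` (`P ≤ 2m`, `s ≤ a·climb P`): weak form … -/
theorem phi_le (P s : ℕ) (hP : P ≤ 2 * (n + 1)) (hs : s ≤ a * climb n P) (r' b : Fin (n + 1)) (l : Fin (a + 3)) :
    phi a n (th a n P s) r' b l ≤ phi a n (th a n P s) (rot n (P % (n + 1)) b) b (lam a n P s b) := by
  rw [phi_eq, phi_cterm a n _ P s hP b]
  have hsm : s ≤ a * (n + 1) := hs.trans (Nat.mul_le_mul_left _ (by unfold climb; split_ifs <;> omega))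
  have hsW : s < width a n := by unfold width; omega
  have hB0 := bonus_grid_nonneg a n P s hs b
  have hlin := bonus_le_linear a n (th a n P s) (eshift a n r' b l) (cnt n r' b) (pos n r' b) (cnt_nonneg n r' b)
    (pos_nonneg n r' b) (lo a l)
  have hlo := lo_le a l
  have hloz : (0 : ℤ) ≤ (lo a l : ℤ) := by positivity
  have hloA : (lo a l : ℤ) ≤ a := by exact_mod_cast hlo
  set q := eshift a n r' b l with hq
  rcases lt_trichotomy q P with hlt | heq | hgt
  · obtain ⟨h1, h2⟩ := gval_gap_of_lt a n P s q hlt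
    set X := th a n P s - 2 * (width a n : ℤ) * q - 2 with hX
    -- `lo·X ≤ max(0, a·X)`
    by_cases hX0 : 0 ≤ X
    · have : (lo a l : ℤ) * X ≤ (a : ℤ) * X := mul_le_mul_of_nonneg_right hloA hX0
      linarith
    · have : (lo a l : ℤ) * X ≤ 0 := mul_nonpos_of_nonneg_of_nonpos hloz (by linarith)
      linarith
  · -- same effective shift: same entry, same high digit
    have heq' : eshift a n r' b l = P := by rw [← hq]; exact heq
    obtain ⟨hr', hhi⟩ := cell_of_eshift_eq a n P r' b l heq'
    rw [heq]
    by_cases hc : hcol n P b = 1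
    · -- a climbing column: compare rungs with identical companion count and position
      have hcnt : cnt n r' b = climb n P := by rw [hr']; exact cnt_cterm n P b hc
      have hpos : pos n r' b = pcol n P b := by rw [hr']; exact pos_cterm n P b hc
      have hps : pcol n P b < climb n P := by
        unfold pcol climb; unfold hcol at hc
        have h := Nat.div_add_mod P (n + 1); have hr := ShiftGrid.mod_lt' n P; have hb := b.isLt
        by_cases hw : n + 1 ≤ (b : ℕ) + P % (n + 1)
        · rw [if_pos hw] at hc
          have he : P / (n + 1) = 0 := by omega
          rw [he] at h
          have hPn : P ≤ n := by omega
          rw [if_pos hPn, if_pos hPn]; have : P % (n + 1) = P := Nat.mod_eq_of_lt (by omega); omega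
        · rw [if_neg hw] at hc
          have he : P / (n + 1) = 1 := by omega
          rw [he] at h
          have hPn : ¬ P ≤ n := by omega
          rw [if_neg hPn, if_neg hPn]; omega
      have hj : jcol a n P s b = lvl (climb n P) s (pcol n P b) := by
        unfold jcol; rw [if_pos hc, min_eq_right (lvl_le a _ _ hs _ hps)]
      rw [hcnt, hpos, hj]
      have := bonus_le_lvl a n P s (climb n P) (pcol n P b) hps (lo a l)
      linarith
    · -- a non-climbing column: both rungs are `0`
      have hl0 : lo a l = 0 := lo_eq_zero_of_hi_ne_one a l (by rw [hhi]; exact hc)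
      have hj0 : jcol a n P s b = 0 := by unfold jcol; rw [if_neg hc]
      rw [hl0, hj0]
      unfold bonus priceSum; simp
  · have h1 := gval_gap_of_gt a n P s hsW q hgt
    have hX : th a n P s - 2 * (width a n : ℤ) * q - 2 < 0 := by
      unfold th
      have hs' : (s : ℤ) ≤ (a : ℤ) * (n + 1) := by exact_mod_cast hsm
      have hW := width_cast a n
      have : (P : ℤ) + 1 ≤ q := by linarith
      nlinarith
    have : (lo a l : ℤ) * (th a n P s - 2 * (width a n : ℤ) * q - 2) ≤ 0 :=
      mul_nonpos_of_nonneg_of_nonpos hloz hX.le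
    linarith

/-- … and strict form: strictly less unless it IS the grid term's incidence. -/
theorem phi_lt (P s : ℕ) (hP : P ≤ 2 * (n + 1)) (hs : s ≤ a * climb n P) (r' b : Fin (n + 1)) (l : Fin (a + 3))
    (hne : r' ≠ rot n (P % (n + 1)) b ∨ l ≠ lam a n P s b) :
    phi a n (th a n P s) r' b l < phi a n (th a n P s) (rot n (P % (n + 1)) b) b (lam a n P s b) := by
  rw [phi_eq, phi_cterm a n _ P s hP b]
  have hsm : s ≤ a * (n + 1) := hs.trans (Nat.mul_le_mul_left _ (by unfold climb; split_ifs <;> omega))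
  have hsW : s < width a n := by unfold width; omega
  have hB0 := bonus_grid_nonneg a n P s hs b
  have hlin := bonus_le_linear a n (th a n P s) (eshift a n r' b l) (cnt n r' b) (pos n r' b) (cnt_nonneg n r' b)
    (pos_nonneg n r' b) (lo a l)
  have hlo := lo_le a l
  have hloz : (0 : ℤ) ≤ (lo a l : ℤ) := by positivity
  have hloA : (lo a l : ℤ) ≤ a := by exact_mod_cast hlo
  set q := eshift a n r' b l with hq
  rcases lt_trichotomy q P with hlt | heq | hgt
  · obtain ⟨h1, h2⟩ := gval_gap_of_lt a n P s q hlt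
    set X := th a n P s - 2 * (width a n : ℤ) * q - 2 with hX
    by_cases hX0 : 0 ≤ X
    · have : (lo a l : ℤ) * X ≤ (a : ℤ) * X := mul_le_mul_of_nonneg_right hloA hX0
      linarith
    · have : (lo a l : ℤ) * X ≤ 0 := mul_nonpos_of_nonneg_of_nonpos hloz (by linarith)
      linarith
  · have heq' : eshift a n r' b l = P := by rw [← hq]; exact heq
    obtain ⟨hr', hhi⟩ := cell_of_eshift_eq a n P r' b l heq'
    have hl : l ≠ lam a n P s b := by
      rcases hne with h1 | h1
      · exact absurd hr' h1
      · exact h1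
    -- the classes differ, with the same high digit: so the low rungs differ (and the column climbs)
    have hlo' : lo a l ≠ jcol a n P s b := by
      intro hc'
      apply hl
      apply eq_of_digits a
      · rw [hhi, hi_lam a n P s hP]
      · rw [hc', lo_lam]
    rw [heq]
    by_cases hc : hcol n P b = 1
    · have hcnt : cnt n r' b = climb n P := by rw [hr']; exact cnt_cterm n P b hc
      have hpos : pos n r' b = pcol n P b := by rw [hr']; exact pos_cterm n P b hc
      have hps : pcol n P b < climb n P := by
        unfold pcol climb; unfold hcol at hc
        have h := Nat.div_add_mod P (n + 1); have hr := ShiftGrid.mod_lt' n P; have hb := b.isLt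
        by_cases hw : n + 1 ≤ (b : ℕ) + P % (n + 1)
        · rw [if_pos hw] at hc
          have he : P / (n + 1) = 0 := by omega
          rw [he] at h
          have hPn : P ≤ n := by omega
          rw [if_pos hPn, if_pos hPn]; have : P % (n + 1) = P := Nat.mod_eq_of_lt (by omega); omega
        · rw [if_neg hw] at hc
          have he : P / (n + 1) = 1 := by omega
          rw [he] at h
          have hPn : ¬ P ≤ n := by omega
          rw [if_neg hPn, if_neg hPn]; omega
      have hj : jcol a n P s b = lvl (climb n P) s (pcol n P b) := by
        unfold jcol; rw [if_pos hc, min_eq_right (lvl_le a _ _ hs _ hps)]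
      rw [hcnt, hpos, hj]
      rw [hj] at hlo'
      have := bonus_lt_lvl a n P s (climb n P) (pcol n P b) hps (lo a l) hlo'
      linarith
    · exfalso
      have hl0 : lo a l = 0 := lo_eq_zero_of_hi_ne_one a l (by rw [hhi]; exact hc)
      have hj0 : jcol a n P s b = 0 := by unfold jcol; rw [if_neg hc]
      exact hlo' (by rw [hl0, hj0])
  · have h1 := gval_gap_of_gt a n P s hsW q hgt
    have hX : th a n P s - 2 * (width a n : ℤ) * q - 2 < 0 := by
      unfold th
      have hs' : (s : ℤ) ≤ (a : ℤ) * (n + 1) := by exact_mod_cast hsm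
      have hW := width_cast a n
      have : (P : ℤ) + 1 ≤ q := by linarith
      nlinarith
    have : (lo a l : ℤ) * (th a n P s - 2 * (width a n : ℤ) * q - 2) ≤ 0 :=
      mul_nonpos_of_nonneg_of_nonpos hloz hX.le
    linarith

/-- **the grid term of `(P, s)` is the unique optimum at `θ(P,s)`**, for all `P ≤ 2m`, `s ≤ a·climb P`. -/
theorem isDominant_cterm (P s : ℕ) (hP : P ≤ 2 * (n + 1)) (hs : s ≤ a * climb n P) :
    IsDominant (dd a n) (vv a n) (ee a n) (th a n P s) (cterm a n P s) := by
  refine ⟨?_, ?_⟩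
  · unfold termSign cterm
    refine mul_ne_zero (Units.ne_zero _) ?_
    rw [Finset.prod_ne_zero_iff]
    intro b _
    exact ee_ne_zero a n _ b _
  · intro q hq _
    rw [tropWeight_eq_sum_phi, tropWeight_eq_sum_phi]
    obtain ⟨b₀, hb₀⟩ : ∃ b, q.1 b ≠ rot n (P % (n + 1)) b ∨ q.2 b ≠ lam a n P s b := by
      by_contra hcon
      push Not at hcon
      apply hq
      unfold cterm
      exact Prod.ext (Equiv.ext fun b => (hcon b).1) (funext fun b => (hcon b).2)
    unfold cterm
    exact Finset.sum_lt_sum (fun b _ => phi_le a n P s hP hs (q.1 b) b (q.2 b))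
      ⟨b₀, Finset.mem_univ _, phi_lt a n P s hP hs (q.1 b₀) b₀ (q.2 b₀) hb₀⟩

end ShiftDiamond
end Summit.ValiantsHypothesis.ValiantsHypothesis.Theorems.LacunarySymmetroidMatrixDescartes.TropicalCensus
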